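import Summits.QuantumFields.YangMills.Theorems.BalabanUVNodesK0PortChart44DMapsTo
import Summits.QuantumFields.YangMills.Theorems.BalabanUVNodesK0RecordFormatNamesLemmas2
import Literature.MathematicalPhysics.QuantumFieldTheory.Balaban1983to89.Node00.CriticalOnFibreTopGuardedBPrint

/-!
# PT-C = `stmt-QuantumFields-27932` (`PortRowE118U2`, text 27932⁗ = (R-J) J edition, CRIT-1 `set-signature` 23:07Z 2026-08-30):
# print's (4.4) chart obligation `Chart44D` HOLDS at the record's TWO-BLOCK names — the row's text, PROVED

[I] = T. Bałaban, *Renormalization group approach to lattice gauge field theories. I*, Commun. Math. Phys. **109** (1987)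
249–301 [Balaban1987RG1]: (1.9) p. 261 (the pair `(𝐔, 𝐉)`), (1.10)–(1.16) p. 262 (the four conditions, the union of orbits
`U^c_{k+1}(X, α₀, α₁)`), (4.4) p. 281 ∕ (3.14) p. 272 (the analyticity domain).

Cell `pub-ymgap`, seat `pub-ymgap-dag-n07-e` g37 — director-ym №447 (PT-C MINE), №449 ∕ CRIT-1 ‼ (R-J) (closer only against the
re-signed J text; typer-1's `nodeO-cover/TYPER-Sig27932-v4-J.txt`, DEF-1 names ed. 7 ✓p793840 `…J` layer, lemmas `…Lemmas2`
✓p793940∕✓p794044).  `--kind proof --workitem stmt-QuantumFields-27932`.  REUSED BY NAME, nothing restated: DEF-1's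
`convex_balanced_isOpen_recordDom44J`, `zero_mem_recordDom44J`, `chartMatULM`, `chartMatJcLM`, `decodeCfg_encodeCfg`; this seat's
✓p794452 `K0PortChart44DMapsTo.satisfies_chartPair` (conditions (i)–(iv) of record for the charted pair, generic 𝐉-slot); porter PTC-1's
✓p794088 (`det_exp` bookkeeping via `expUnit_chartMat_mem_Gc`); `B12RegularSpaces111.mem_space_of_satisfies`.

WHAT IS PROVED (kernel, no hypothesis beyond the signature's own).  With the EXPLICIT, k-UNIFORM radius `α₂ := min (1∕4) (min α₁ (α₀∕36))`:
* §1 the U-block READ-OFF `w ↦ (i ↦ w_{U, bond i, colour i})` carries `chartMatU` to `chartMat` (`chartMat_readU`) and the two-block (4.4)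
  domain `recordDom44J … α₂` into the one-block one `recordDom44 … α₂` (`readU_mem_recordDom44`); the `𝐉`-block matrices are traceless;
* §2 **the two-block chart `recordChartJ F Mc k K X` is ENTIRE** (`analyticAt_recordChartJ`: per coordinate an entry functional ∘
  (`NormedSpace.exp` ∘ `chartMatULM` | `chartMatJcLM` | constant), `AnalyticAt.pi`);
* §3 **`Set.MapsTo (recordChartJ F Mc k K X) (recordDom44J F Mc k K X α₂) (recordUc F Mc k α₀ α₁ K X)`** (`recordChartJ_mapsTo`):
  the charted PAIR `(exp W_U on X ∕ 1 off, W_J on X ∕ 0 off)` satisfies (i)–(iv) of record by `satisfies_chartPair` at the U-block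
  read-off, the 𝐉-slot being traceless with `‖W_J(b)‖ < α₂ ≤ α₀∕36 < α₀ = γ₀` (print's (1.14) «|𝐉| < γ₀»); membership in the union of
  orbits (own orbit, `u = 1`) read back through `decodeCfg ∘ encodeCfg = id`;
* §4 the six (4.4) clauses per `(K, X)` (`chart44J_clauses`), DEF-1's receipt **`Chart44DAtJ F Mc k α₀ α₁ α₂`** (`chart44DAtJ_record`),
  `B12FormatPlus.Chart44D` at the shifted volumes `recordK₀ F Mc k + n` (`chart44DJ_record`), and **the signed text VERBATIM**
  (`portRowE118U2_sig`) — whose N07 antecedents (Theorem 1 ∕ the gauge-(9) token at print's datum) are not used.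

HONEST FRAMING (director-ym №447 (4) ∕ №449 annexes, displayed).  A statement about the record's CHART and SPACES only: condition (iv)
(1.15)–(1.16) is met VACUOUSLY at the record's UNIT residual recipe (`RzOfRecord = Sect2.Residual.unit`, `condIV_record`), so this row is
names-side bookkeeping plus ONE plaquette estimate — NOT a port of [I] (3.36)–(3.54) ∕ (1.18) ∕ Theorem 3 (the analyticity and bounds of the
PIECES `𝐄(X; 𝐔, 𝐉)` are 27930's `FormatPlus` rows); closing 27932 at THIS record is a closure AT THE RECORD AS DEFINED, the placeholder swap
being a separate docketed event.  Count-neutral porter row (rank 9); 27930 ∕ 27931 ∕ 26648 OPEN; K0⁷ `Record13SepCoPHInhabited` NOT closed;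
NODE O not inhabited; COUNT 8∕28 · K 1∕4 UNMOVED; one finite `𝕋⁴_{L^K}` programme at fixed ε — NOT continuum ∕ ℝ⁴ ∕ OS; **the Yang–Mills mass
gap (Clay) is NOT proved by any of this.**  No `sorry`, no `def`, no `instance`, no `notation`; standard axioms.
-/

noncomputable section

open scoped BigOperators Matrix.Norms.L2Operator

namespace Summit.QuantumFields.YangMills.Theorems.K0PortChart44DAtRecord

open Literature.MathematicalPhysics.QuantumFieldTheory.Balaban1983to89
open Literature.MathematicalPhysics.QuantumFieldTheory.Balaban1983to89.Node00
open Literature.MathematicalPhysics.QuantumFieldTheory.Balaban1983to89.T4Continuum (T4Family)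
open Summit.QuantumFields.YangMills.Theorems.K0RecordFormatNames
open Summit.QuantumFields.YangMills.Theorems.K0PortChart44DMapsTo
open NormedSpace (exp)

section Record

variable (F : T4Family)

/-! ## §1  The U-block read-off `recordDom44J → recordDom44`; the `𝐉`-block is traceless -/

/-- The U-block read-off carries `chartMat` to `chartMatU`: `chartMat F K (i ↦ w (b_i, inl a_i)) b = chartMatU F K w b`.
[cite: Balaban1987RG1, (1.9) p.261, p.258 (bookkeeping)] -/
theorem chartMat_readU (K : ℕ) (w : Fin (recordChartDimJ F K) → ℂ) (b : PBond (F.P K) 0) :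
    chartMat F K (fun i => w (chartEquivJ F K (((chartEquiv F K).symm i).1, Sum.inl ((chartEquiv F K).symm i).2))) b =
      chartMatU F K w b := by
  simp [chartMat, chartMatU]

/-- The U-block read-off carries the two-block (4.4) domain into the one-block one (the three scaled clauses are the same words on `chartMatU`).
[cite: Balaban1987RG1, (4.4) p.281, (3.14) p.272] -/
theorem readU_mem_recordDom44 (Mc k K : ℕ) (X : (recordDomSys F Mc k K).Dom) (α₂ : ℝ) {w : Fin (recordChartDimJ F K) → ℂ}
    (hw : w ∈ recordDom44J F Mc k K X α₂) :
    (fun i => w (chartEquivJ F K (((chartEquiv F K).symm i).1, Sum.inl ((chartEquiv F K).symm i).2))) ∈ recordDom44 F Mc k K X α₂ := by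
  obtain ⟨h1, h2, h3, -⟩ := hw
  refine ⟨fun b hb => ?_, fun b hb μ hμ => ?_, fun b hb hμ => ?_⟩
  · rw [chartMat_readU]; exact h1 b hb
  · rw [chartMat_readU, chartMat_readU]; exact h2 b hb μ hμ
  · simp only [chartMat_readU]; exact h3 b hb hμ

/-- The `𝐉`-block matrices are traceless (`τ_a ∈ 𝔰𝔩₂(ℂ)`). [cite: Balaban1987RG1, (1.9)–(1.10) pp.261–262] -/
theorem trace_chartMatJc (K : ℕ) (w : Fin (recordChartDimJ F K) → ℂ) (b : PBond (F.P K) 0) : (chartMatJc F K w b).trace = 0 := by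
  simp [chartMatJc, sl2Gen, Matrix.trace_fin_two, Fin.sum_univ_three]

/-! ## §2  The two-block chart of record is entire -/

/-- **The two-block chart of record is analytic everywhere**: per coordinate an entry functional of `exp ∘ chartMatULM` (U-block on `X`),
of `chartMatJcLM` (𝐉-block on `X`), or a constant (off `X`). [cite: Balaban1987RG1, (1.9) p.261, p.258, (4.4) p.281] -/
theorem analyticAt_recordChartJ (Mc k K : ℕ) (X : (recordDomSys F Mc k K).Dom) (w : Fin (recordChartDimJ F K) → ℂ) :
    AnalyticAt ℂ (recordChartJ F Mc k K X) w := by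
  classical
  have hcoord : ∀ n, AnalyticAt ℂ (fun w => recordChartJ F Mc k K X w n) w := by
    intro n
    have hE := (LinearMap.toContinuousLinearMap
      (Matrix.entryLinearMap ℂ ℂ ((cfgEquiv F K).symm n).2.1 ((cfgEquiv F K).symm n).2.2)).analyticAt
    rcases hc : ((cfgEquiv F K).symm n).1 with b | b
    · by_cases hb : b ∈ domBonds F Mc k K X
      · have h1 : AnalyticAt ℂ (fun w => chartMatU F K w b) w := (LinearMap.toContinuousLinearMap (chartMatULM F K b)).analyticAt w
        have h2 : AnalyticAt ℂ (exp ∘ fun w => chartMatU F K w b) w :=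
          AnalyticAt.comp (f := fun w => chartMatU F K w b) (x := w) (NormedSpace.exp_analytic (𝕂 := ℂ) _) h1
        refine ((hE _).comp h2).congr (Filter.Eventually.of_forall fun w' => ?_)
        simp only [Function.comp_apply, LinearMap.coe_toContinuousLinearMap', Matrix.entryLinearMap_apply, recordChartJ,
          encodeCfg, hc, Sum.elim_inl, if_pos hb]
      · refine (analyticAt_const (v := (1 : MatA 2) ((cfgEquiv F K).symm n).2.1 ((cfgEquiv F K).symm n).2.2)).congr
          (Filter.Eventually.of_forall fun w' => ?_)
        simp only [recordChartJ, encodeCfg, hc, Sum.elim_inl, if_neg hb]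
    · by_cases hb : b ∈ domBonds F Mc k K X
      · have h1 : AnalyticAt ℂ (fun w => chartMatJc F K w b) w := (LinearMap.toContinuousLinearMap (chartMatJcLM F K b)).analyticAt w
        refine ((hE _).comp h1).congr (Filter.Eventually.of_forall fun w' => ?_)
        simp only [Function.comp_apply, LinearMap.coe_toContinuousLinearMap', Matrix.entryLinearMap_apply, recordChartJ,
          encodeCfg, hc, Sum.elim_inr, if_pos hb]
      · refine (analyticAt_const (v := (0 : MatA 2) ((cfgEquiv F K).symm n).2.1 ((cfgEquiv F K).symm n).2.2)).congr
          (Filter.Eventually.of_forall fun w' => ?_)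
        simp only [recordChartJ, encodeCfg, hc, Sum.elim_inr, if_neg hb]
  exact AnalyticAt.pi (f := fun n w => recordChartJ F Mc k K X w n) hcoord

/-! ## §3  The two-block chart maps the two-block (4.4) domain into `U^c_{k+1}(X, α₀, α₁)` of record -/

/-- **THE MEMBERSHIP (MapsTo) CLAUSE for the two-block chart.**  For `w = (w_U, w_J)` in `recordDom44J … α₂` (`0 < α₂ ≤ 1∕4`, `α₂ ≤ α₁`,
`α₂ ≤ α₀∕36`) the charted pair `(exp W_U, W_J)` on `X` (`(1, 0)` off `X`) lies in `U^c_{k+1}(X, α₀, α₁)` OF RECORD: conditions (i)–(iv) by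
`satisfies_chartPair` at the U-block read-off with the 𝐉-slot `W_J` (traceless, `‖W_J(b)‖ < α₂ < α₀ = γ₀`), then its own orbit (`u = 1`).
[cite: Balaban1987RG1, (1.9)–(1.16) pp.261–262, (4.4) p.281] -/
theorem recordChartJ_mapsTo (Mc k K : ℕ) (X : (recordDomSys F Mc k K).Dom) {α₀ α₁ α₂ : ℝ} (hα₀ : 0 < α₀) (hα₂ : 0 < α₂)
    (hα₂q : α₂ ≤ 1 / 4) (hα₂₁ : α₂ ≤ α₁) (hα₂₀ : α₂ ≤ α₀ / 36) :
    Set.MapsTo (recordChartJ F Mc k K X) (recordDom44J F Mc k K X α₂) (recordUc F Mc k α₀ α₁ K X) := by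
  classical
  intro w hw
  have hJ4 : ∀ b ∈ domBonds F Mc k K X, ‖chartMatJc F K w b‖ < α₂ := hw.2.2.2
  have hSat := satisfies_chartPair F Mc k K X hα₀ hα₂ hα₂q hα₂₁ hα₂₀ (readU_mem_recordDom44 F Mc k K X α₂ hw)
    (fun b => if b ∈ domBonds F Mc k K X then chartMatJc F K w b else 0)
    (fun b hb => by simp only [if_pos hb]; exact trace_chartMatJc F K w b)
    (fun b hb => by simp only [if_pos hb]; linarith [hJ4 b hb])
  rw [recordUc, Set.mem_preimage]
  refine ⟨_, B12RegularSpaces111.mem_space_of_satisfies hSat, ?_⟩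
  simp only [recordChartJ, decodeCfg_encodeCfg]
  refine Prod.ext (funext fun b => ?_) (funext fun b => ?_)
  · simp only [Sect2.embedPair, chartMat_readU]
    split_ifs <;> simp
  · simp only [Sect2.embedPair]

/-! ## §4  Assembly: the six (4.4) clauses, the receipt `Chart44DAtJ`, the shifted `Chart44D`, and the signed text verbatim -/

/-- The radius of record is admissible: `0 < α₂ ≤ 1∕4`, `α₂ ≤ α₁`, `α₂ ≤ α₀∕36` for `α₂ := min (1∕4) (min α₁ (α₀∕36))`.
[cite: Balaban1987RG1, (4.4) p.281 (bookkeeping)] -/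
theorem radius_admissible {α₀ α₁ : ℝ} (hα₀ : 0 < α₀) (hα₁ : 0 < α₁) :
    0 < min (1 / 4 : ℝ) (min α₁ (α₀ / 36)) ∧ min (1 / 4 : ℝ) (min α₁ (α₀ / 36)) ≤ 1 / 4 ∧
      min (1 / 4 : ℝ) (min α₁ (α₀ / 36)) ≤ α₁ ∧ min (1 / 4 : ℝ) (min α₁ (α₀ / 36)) ≤ α₀ / 36 :=
  ⟨lt_min (by norm_num) (lt_min hα₁ (by linarith)), min_le_left _ _, (min_le_right _ _).trans (min_le_left _ _),
    (min_le_right _ _).trans (min_le_right _ _)⟩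

/-- **The six (4.4) clauses at the record's two-block names, per volume `K` and domain `X`.** [cite: Balaban1987RG1, (4.4) p.281, (1.9)–(1.16) pp.261–262] -/
theorem chart44J_clauses (Mc k K : ℕ) (X : (recordDomSys F Mc k K).Dom) {α₀ α₁ α₂ : ℝ} (hα₀ : 0 < α₀) (hα₂ : 0 < α₂)
    (hα₂q : α₂ ≤ 1 / 4) (hα₂₁ : α₂ ≤ α₁) (hα₂₀ : α₂ ≤ α₀ / 36) :
    Convex ℝ (recordDom44J F Mc k K X α₂) ∧ Balanced ℂ (recordDom44J F Mc k K X α₂) ∧ IsOpen (recordDom44J F Mc k K X α₂) ∧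
      (0 : Fin (recordChartDimJ F K) → ℂ) ∈ recordDom44J F Mc k K X α₂ ∧
      AnalyticOnNhd ℂ (recordChartJ F Mc k K X) (recordDom44J F Mc k K X α₂) ∧
      Set.MapsTo (recordChartJ F Mc k K X) (recordDom44J F Mc k K X α₂) (recordUc F Mc k α₀ α₁ K X) :=
  ⟨(convex_balanced_isOpen_recordDom44J F Mc k K X α₂).1, (convex_balanced_isOpen_recordDom44J F Mc k K X α₂).2.1,
    (convex_balanced_isOpen_recordDom44J F Mc k K X α₂).2.2, zero_mem_recordDom44J F Mc k K X hα₂,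
    fun w _ => analyticAt_recordChartJ F Mc k K X w, recordChartJ_mapsTo F Mc k K X hα₀ hα₂ hα₂q hα₂₁ hα₂₀⟩

/-- **DEF-1's receipt `Chart44DAtJ` (names module §16) HOLDS at `α₂ = min (1∕4) (min α₁ (α₀∕36))`, every `Mc`, `k`.**
[cite: Balaban1987RG1, (4.4) p.281, (1.9)–(1.16) pp.261–262] -/
theorem chart44DAtJ_record (Mc k : ℕ) {α₀ α₁ : ℝ} (hα₀ : 0 < α₀) (hα₁ : 0 < α₁) :
    Chart44DAtJ F Mc k α₀ α₁ (min (1 / 4 : ℝ) (min α₁ (α₀ / 36))) := by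
  obtain ⟨h0, hq, h1, h36⟩ := radius_admissible hα₀ hα₁
  exact fun K X => chart44J_clauses F Mc k K X hα₀ h0 hq h1 h36

/-- **`B12FormatPlus.Chart44D` at the two-block names on the shifted volumes `recordK₀ F Mc k + n`** (the mould of the signed text).
[cite: Balaban1987RG1, (4.4) p.281, (1.9)–(1.16) pp.261–262] -/
theorem chart44DJ_record (Mc k : ℕ) {α₀ α₁ : ℝ} (hα₀ : 0 < α₀) (hα₁ : 0 < α₁) :
    B12FormatPlus.Chart44D (fun n => recordDomSys F Mc k (recordK₀ F Mc k + n))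
      (fun n => recordBondCount F (recordK₀ F Mc k + n)) (fun n => recordUc F Mc k α₀ α₁ (recordK₀ F Mc k + n))
      (fun n => recordChartDimJ F (recordK₀ F Mc k + n)) (fun n => recordChartJ F Mc k (recordK₀ F Mc k + n))
      (fun n X => recordDom44J F Mc k (recordK₀ F Mc k + n) X (min (1 / 4 : ℝ) (min α₁ (α₀ / 36)))) := by
  obtain ⟨h0, hq, h1, h36⟩ := radius_admissible hα₀ hα₁
  exact fun n X => chart44J_clauses F Mc k (recordK₀ F Mc k + n) X hα₀ h0 hq h1 h36

end Record

/-- **PT-C = `stmt-QuantumFields-27932` `PortRowE118U2`, the signed text 27932⁗ ((R-J) J edition, `TYPER-Sig27932-v4-J.txt`) VERBATIM: PROVED.**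
The N07 antecedents are not used: the chart obligation holds at the names for every `F`, `Mc`, `k`, with `α₂ := min (1∕4) (min α₁ (α₀∕36))`.
[cite: Balaban1987RG1, (4.4) p.281, (1.9)–(1.16) pp.261–262] -/
theorem portRowE118U2_sig :
    ∀ (F : Literature.MathematicalPhysics.QuantumFieldTheory.Balaban1983to89.T4Continuum.T4Family) (Mc : ℕ) (j c c₀ c₁ : ℕ) (B₃ B₃' a₀ a₁ : ℝ), Summit.QuantumFields.YangMills.Theorems.K0RecordFormatNames.McGuard F Mc → c ≤ F.L ^ j → c₀ ≤ j + 1 → c₁ ≤ j → 2 * (F.L : ℝ) ^ 2 ≤ B₃ → 0 < B₃' → 0 < a₀ → 0 < a₁ → Literature.MathematicalPhysics.QuantumFieldTheory.Balaban1983to89.Node00.VariationalThm1RegSepCoP7MGB F 2 (fun ν M g K k _s => c ≤ ν.M₁ ∧ k + c₀ ≤ F.m + K ∧ F.L ^ c₁ ∣ M ∧ ∀ i, 1 ≤ i → i ≤ k → Literature.MathematicalPhysics.QuantumFieldTheory.Balaban1983to89.Node00.dCubeSide (F.P K).L M (Literature.MathematicalPhysics.QuantumFieldTheory.Balaban1983to89.Node00.RkOfRecord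 (F.P K).L ν.r (g i)) i ∣ (F.P K).sitesPerDir 0) (Literature.MathematicalPhysics.QuantumFieldTheory.Balaban1983to89.Node00.lamDatum F) (Literature.MathematicalPhysics.QuantumFieldTheory.Balaban1983to89.Node00.dataSmall7LamTopOf F 2) B₃ a₀ a₁ → Literature.MathematicalPhysics.QuantumFieldTheory.Balaban1983to89.Node00.Gauge9RegSepTopStepGB F 2 (fun ν K Ω => Literature.MathematicalPhysics.QuantumFieldTheory.Balaban1983to89.Node00.suppDomOfRecord F ν K Ω) (F.L ^ j) (fun ν M g K k _s => c ≤ ν.M₁ ∧ k + c₀ ≤ F.m + K ∧ F.L ^ c₁ ∣ M ∧ ∀ i, 1 ≤ i → i ≤ k → Literature.MathematicalPhysics.QuantumFieldTheory.Balaban1983to89.Node00.dCubeSide (F.P K).L M (Literature.MathematicalPhysics.QuantumFieldTheory.Balaban1983to89.Node00.RkOfRecord (F.P K).L ν.r (g i)) i ∣ (F.P K).sitesPerDir 0) (Literature.MathematicalPhysics.QuantumFieldTheory.Balaban1983to89.Node00.lamDatum F) (Literature.MathematicalPhysics.QuantumFieldTheory.Balaban1983to89.Node00.dataSmall7LamTopOf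 F 2) B₃ B₃' a₀ a₁ → ∀ α₀ α₁ : ℝ, 0 < α₀ → 0 < α₁ → ∃ α₂ : ℝ, 0 < α₂ ∧ ∀ k : ℕ, Literature.MathematicalPhysics.QuantumFieldTheory.Balaban1983to89.B12FormatPlus.Chart44D (fun n => Summit.QuantumFields.YangMills.Theorems.K0RecordFormatNames.recordDomSys F Mc k (Summit.QuantumFields.YangMills.Theorems.K0RecordFormatNames.recordK₀ F Mc k + n)) (fun n => Summit.QuantumFields.YangMills.Theorems.K0RecordFormatNames.recordBondCount F (Summit.QuantumFields.YangMills.Theorems.K0RecordFormatNames.recordK₀ F Mc k + n)) (fun n => Summit.QuantumFields.YangMills.Theorems.K0RecordFormatNames.recordUc F Mc k α₀ α₁ (Summit.QuantumFields.YangMills.Theorems.K0RecordFormatNames.recordK₀ F Mc k + n)) (fun n => Summit.QuantumFields.YangMills.Theorems.K0RecordFormatNames.recordChartDimJ F (Summit.QuantumFields.YangMills.Theorems.K0RecordFormatNames.recordK₀ F Mc k + n)) (fun n => Summit.QuantumFields.YangMills.Theorems.K0RecordFormatNames.recordChartJ F Mc k (Summit.QuantumFields.YangMills.Theorems.K0RecordFormatNames.recordK₀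 F Mc k + n)) (fun n X => Summit.QuantumFields.YangMills.Theorems.K0RecordFormatNames.recordDom44J F Mc k (Summit.QuantumFields.YangMills.Theorems.K0RecordFormatNames.recordK₀ F Mc k + n) X α₂) := by
  intro F Mc j c c₀ c₁ B₃ B₃' a₀ a₁ _ _ _ _ _ _ _ _ _ _ α₀ α₁ hα₀ hα₁
  exact ⟨min (1 / 4 : ℝ) (min α₁ (α₀ / 36)), (radius_admissible hα₀ hα₁).1, fun k => chart44DJ_record F Mc k hα₀ hα₁⟩

end Summit.QuantumFields.YangMills.Theorems.K0PortChart44DAtRecord
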